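import Mathlib
import HarnessLib

/-!
# Route `UnthreadedDoor`, crux `PoloidalLiouville` (stmt-NavierStokesRegularity-1222), WALL W1 — crux idea «cell-flux», support toward
# Σ-0bR₂ `ClusterFluxNearCentreLipschitz`: the LIPSCHITZ SELECTION LEMMA («re-grouping events»)

Pure real analysis, no Navier–Stokes object.  The docstring of Σ-0bR₂ (`Theorems/UnthreadedDoorCellFluxWindowDecayDefs.lean`, p726325)
names as its M content «the envelope bound across re-grouping events between different sheet components»: the cluster flux of an admissible
rule is, at every radius (resp. time), the flux of ONE of finitely many grouping patterns of the cells, it is jointly continuous, and a rule may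
switch pattern only where two pattern fluxes agree.  The abstract tool that turns per-pattern Lipschitz bounds into a bound for the rule's flux is:

* `abs_sub_le_of_finset_closed_cover` — if `[x, y]` is covered by finitely many CLOSED sets on each of which `f` satisfies
  `|f w − f u| ≤ K |w − u|`, then `|f y − f x| ≤ K (y − x)` (chain argument: leave each closed piece through its last point in `[x, y]`,
  which lies in another piece; induction on the number of pieces — no continuity hypothesis is needed);
* `lipschitzOnWith_of_finite_closed_cover` — the `LipschitzOnWith` form on an order-connected set of `ℝ`;
* `lipschitzOnWith_of_continuous_selection` — a continuous `f` that at every point of an order-connected set agrees with one of finitely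
  many `K`-Lipschitz continuous branches is `K`-Lipschitz (the pieces `{f = gᵢ} ∩ [x, y]` are closed).

HONEST LABEL: a calculus tool strictly below W1; Σ-0bR₂, the cell-flux chain, `PoloidalLiouville` ⟨1222⟩, W1 and NS regularity are OPEN —
NOT proved.  `--supports stmt-NavierStokesRegularity-1222 --as helper`.  [folklore]
-/

noncomputable section

-- the summit and its single sub-problem share the name (CONVENTIONS §1)
set_option linter.dupNamespace false

open Set Function Filter Topology
open scoped NNReal

namespace Summit.NavierStokesRegularity.NavierStokesRegularity.Theorems.PoloidalLiouville.CellFlux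

/-- **Chain lemma (finite closed cover of a compact interval).**  If `[x, y]` is covered by the closed sets `A i`, `i ∈ F` (`F` a finset),
and on each piece `A i ∩ [x, y]` the function `f` satisfies `|f w − f u| ≤ K |w − u|`, then `|f y − f x| ≤ K (y − x)`.
Proof: induction on `F.card`; `x ∈ A i₀`; `x₁ := sup (A i₀ ∩ [x, y]) ∈ A i₀`; the first leg costs `K (x₁ − x)`; if `x₁ < y` then
`(x₁, y]` avoids `A i₀`, so `[x₁, y] = closure (x₁, y]` is covered by the remaining (closed) pieces and the induction hypothesis pays the
second leg. [folklore] -/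
theorem abs_sub_le_of_finset_closed_cover {ι : Type*} (f : ℝ → ℝ) (K : ℝ) (A : ι → Set ℝ) (hA : ∀ i, IsClosed (A i)) (y : ℝ) :
    ∀ (n : ℕ) (F : Finset ι) (x : ℝ), F.card = n → x ≤ y → Icc x y ⊆ (⋃ i ∈ F, A i) →
      (∀ i ∈ F, ∀ u ∈ A i ∩ Icc x y, ∀ w ∈ A i ∩ Icc x y, |f w - f u| ≤ K * |w - u|) →
      |f y - f x| ≤ K * (y - x) := by
  classical
  intro n
  induction n with
  | zero =>
    intro F x hF hxy hcov _
    have hx : x ∈ ⋃ i ∈ F, A i := hcov (left_mem_Icc.2 hxy)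
    rw [Finset.card_eq_zero] at hF
    subst hF
    simp at hx
  | succ n ih =>
    intro F x hF hxy hcov hlip
    have hx : x ∈ ⋃ i ∈ F, A i := hcov (left_mem_Icc.2 hxy)
    obtain ⟨i₀, hi₀F, hxi₀⟩ : ∃ i ∈ F, x ∈ A i := by simpa only [mem_iUnion, exists_prop] using hx
    set B : Set ℝ := A i₀ ∩ Icc x y with hB
    have hBc : IsClosed B := (hA i₀).inter isClosed_Icc
    have hxB : x ∈ B := ⟨hxi₀, left_mem_Icc.2 hxy⟩
    have hBne : B.Nonempty := ⟨x, hxB⟩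
    have hBbdd : BddAbove B := ⟨y, fun z hz => hz.2.2⟩
    set x₁ : ℝ := sSup B with hx₁
    have hx₁B : x₁ ∈ B := hBc.csSup_mem hBne hBbdd
    have hxx₁ : x ≤ x₁ := le_csSup hBbdd hxB
    have hx₁y : x₁ ≤ y := hx₁B.2.2
    -- first leg, inside the piece `A i₀`
    have h1 : |f x₁ - f x| ≤ K * (x₁ - x) := by
      have h := hlip i₀ hi₀F x hxB x₁ hx₁B
      rwa [abs_of_nonneg (sub_nonneg.2 hxx₁)] at h
    rcases eq_or_lt_of_le hx₁y with hEq | hlt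
    · rw [← hEq]
      exact h1
    · -- the remaining pieces cover `[x₁, y]`
      set C : Set ℝ := ⋃ i ∈ F.erase i₀, A i with hC
      have hCc : IsClosed C := isClosed_biUnion_finset fun i _ => hA i
      have hIoc : Ioc x₁ y ⊆ C := by
        intro z hz
        have hz' : z ∈ Icc x y := ⟨hxx₁.trans hz.1.le, hz.2⟩
        obtain ⟨i, hiF, hzi⟩ : ∃ i ∈ F, z ∈ A i := by
          simpa only [mem_iUnion, exists_prop] using hcov hz'
        have hne : i ≠ i₀ := by
          rintro rfl
          exact absurd (le_csSup hBbdd ⟨hzi, hz'⟩) (not_le.2 hz.1)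
        simp only [hC, mem_iUnion, exists_prop]
        exact ⟨i, Finset.mem_erase.2 ⟨hne, hiF⟩, hzi⟩
      have hcov' : Icc x₁ y ⊆ C := by
        have hcl : closure (Ioc x₁ y) ⊆ C := closure_minimal hIoc hCc
        rwa [closure_Ioc hlt.ne] at hcl
      have hcard : (F.erase i₀).card = n := by
        rw [Finset.card_erase_of_mem hi₀F, hF]
        rfl
      have hlip' : ∀ i ∈ F.erase i₀, ∀ u ∈ A i ∩ Icc x₁ y, ∀ w ∈ A i ∩ Icc x₁ y, |f w - f u| ≤ K * |w - u| := by
        intro i hi u hu w hw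
        exact hlip i (Finset.mem_of_mem_erase hi) u ⟨hu.1, hxx₁.trans hu.2.1, hu.2.2⟩ w ⟨hw.1, hxx₁.trans hw.2.1, hw.2.2⟩
      have h2 : |f y - f x₁| ≤ K * (y - x₁) := ih (F.erase i₀) x₁ hcard hlt.le hcov' hlip'
      calc |f y - f x| = |(f y - f x₁) + (f x₁ - f x)| := by ring_nf
        _ ≤ |f y - f x₁| + |f x₁ - f x| := abs_add_le _ _
        _ ≤ K * (y - x₁) + K * (x₁ - x) := add_le_add h2 h1
        _ = K * (y - x) := by ring

/-- **Lipschitz selection across finitely many closed pieces.**  On an order-connected set `s ⊆ ℝ` covered by finitely many closed sets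
`A i`, a function that is `K`-Lipschitz on every `A i ∩ s` is `K`-Lipschitz on `s` (no continuity assumed; the pieces need not be
intervals). [folklore] -/
theorem lipschitzOnWith_of_finite_closed_cover {ι : Type*} [Finite ι] {f : ℝ → ℝ} {K : ℝ≥0} {s : Set ℝ}
    (hs : s.OrdConnected) (A : ι → Set ℝ) (hA : ∀ i, IsClosed (A i)) (hcov : s ⊆ ⋃ i, A i)
    (hf : ∀ i, LipschitzOnWith K f (A i ∩ s)) : LipschitzOnWith K f s := by
  classical
  haveI : Fintype ι := Fintype.ofFinite ι
  -- the real-valued two-point form, for `x ≤ y` in `s`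
  have key : ∀ x ∈ s, ∀ y ∈ s, x ≤ y → |f y - f x| ≤ (K : ℝ) * (y - x) := by
    intro x hx y hy hxy
    have hI : Icc x y ⊆ s := hs.out hx hy
    refine abs_sub_le_of_finset_closed_cover f K A hA y _ Finset.univ x rfl hxy ?_ ?_
    · intro z hz
      have h := hcov (hI hz)
      simpa only [mem_iUnion, Finset.mem_univ, exists_true_left] using h
    · intro i _ u hu w hw
      have h := (hf i).dist_le_mul w ⟨hw.1, hI hw.2⟩ u ⟨hu.1, hI hu.2⟩
      simpa only [Real.dist_eq] using h
  refine LipschitzOnWith.of_dist_le_mul fun x hx y hy => ?_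
  rcases le_total x y with hxy | hyx
  · have h := key x hx y hy hxy
    rw [Real.dist_eq, Real.dist_eq, abs_sub_comm, abs_of_nonpos (sub_nonpos.2 hxy)]
    linarith
  · have h := key y hy x hx hyx
    rw [Real.dist_eq, Real.dist_eq, abs_of_nonneg (sub_nonneg.2 hyx)]
    exact h

/-- **Continuous selections of finitely many Lipschitz branches are Lipschitz.**  If `f` is continuous on an order-connected `s ⊆ ℝ`
and at every point of `s` agrees with one of finitely many continuous `K`-Lipschitz branches `g i`, then `f` is `K`-Lipschitz on `s`
(applied on each `[x, y] ⊆ s` to the closed pieces `{z ∈ [x, y] | f z = g i z}`).  This is the form in which a cluster rule's flux inherits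
the per-pattern bounds across re-grouping events. [folklore] -/
theorem lipschitzOnWith_of_continuous_selection {ι : Type*} [Finite ι] {f : ℝ → ℝ} (g : ι → ℝ → ℝ) {K : ℝ≥0} {s : Set ℝ}
    (hs : s.OrdConnected) (hfc : ContinuousOn f s) (hgc : ∀ i, ContinuousOn (g i) s)
    (hsel : ∀ x ∈ s, ∃ i, f x = g i x) (hg : ∀ i, LipschitzOnWith K (g i) s) : LipschitzOnWith K f s := by
  classical
  -- reduce to compact subintervals `[x, y] ⊆ s`
  have key : ∀ x ∈ s, ∀ y ∈ s, x ≤ y → LipschitzOnWith K f (Icc x y) := by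
    intro x hx y hy _
    have hI : Icc x y ⊆ s := hs.out hx hy
    let A : ι → Set ℝ := fun i => {z | z ∈ Icc x y ∧ f z = g i z}
    have hA : ∀ i, IsClosed (A i) := by
      intro i
      have hc : ContinuousOn (fun z => f z - g i z) (Icc x y) := (hfc.mono hI).sub ((hgc i).mono hI)
      have h := hc.preimage_isClosed_of_isClosed isClosed_Icc (isClosed_singleton (x := (0 : ℝ)))
      convert h using 1
      ext z
      simp only [A, mem_setOf_eq, mem_inter_iff, mem_preimage, mem_singleton_iff, sub_eq_zero]
    refine lipschitzOnWith_of_finite_closed_cover ordConnected_Icc A hA (fun z hz => ?_) (fun i => ?_)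
    · obtain ⟨i, hi⟩ := hsel z (hI hz)
      exact mem_iUnion.2 ⟨i, hz, hi⟩
    · refine LipschitzOnWith.of_dist_le_mul fun u hu w hw => ?_
      have h := (hg i).dist_le_mul u (hI hu.2) w (hI hw.2)
      rwa [← hu.1.2, ← hw.1.2] at h
  refine LipschitzOnWith.of_dist_le_mul fun x hx y hy => ?_
  rcases le_total x y with hxy | hyx
  · exact (key x hx y hy hxy).dist_le_mul x (left_mem_Icc.2 hxy) y (right_mem_Icc.2 hxy)
  · exact (key y hy x hx hyx).dist_le_mul x (right_mem_Icc.2 hyx) y (left_mem_Icc.2 hyx)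

end Summit.NavierStokesRegularity.NavierStokesRegularity.Theorems.PoloidalLiouville.CellFlux

end
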